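/-
Copyright (c) 2026 the pub-hodgecm-mathlib formalisation cell (harness21).  Prover seat hodgecm-mathlib-K2Liu-p01 (g0): Track B «K2-LIT», #184♮ = hLiu418,
STEWARD of socket #41 `sig_K2LiuSiegelEisensteinContinuation` (s5 seam (F0), LEAD F0P6-plan (g10) DEAL 2026-09-03T22:23:03Z) — organ O41.9 «GLUE».
-/
import Mathlib.Analysis.Meromorphic.NormalForm
import Mathlib.Analysis.Complex.CauchyIntegral
import Mathlib.Analysis.Convex.PathConnected
import Mathlib.Analysis.Complex.Convex
import HarnessLib

/-!
# Crux `HLiu418`, road `K2_Liu`, socket #41 `sig_K2LiuSiegelEisensteinContinuation`, organ O41.9: the MEROMORPHIC GLUE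
# (from «meromorphic with controlled orders» to the socket's `(Ec, R)` shape, and the identity principle on `{Re s > a} ∖ {s₀}`)

Cell `hodgecm-mathlib`, crux item hLiu418 = `stmt-HodgeConjecture-24832`; prover K2Liu-p01 (g0), REPORT-FIRST
`K2/K2Liu-p01/g0/REPORT-FIRST-41-SiegelEisensteinContinuation.K2Liup01g0.md` §3 organ O41.9.  THEOREMS ONLY, Mathlib-only, no `sorry`;
lane `--supports stmt-HodgeConjecture-24832 --as helper`.

WHAT IS PROVED (pure complex analysis; `X` is any index type — in the application `X = H(𝔸)` and `E x s = ` a meromorphic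
continuation of `s ↦ E^Δ(x; f_s)` as in ★ `K2Lit.SiegelDoubled.IsEisensteinContinuation`):
* `isPreconnected_halfPlane_diff_singleton`: `Ω = {Re s > a} ∖ {s₀}` is open and preconnected (four convex pieces);
* `tendsto_sub_mul_of_neg_one_le_meromorphicOrderAt`: order `≥ −1` at `s₀` ⇒ `(s − s₀)·g(s)` has a limit along `𝓝[≠] s₀`;
* `differentiableOn_toMeromorphicNFOn`, `toMeromorphicNFOn_eqOn_of_differentiableOn`: Mathlib's normal form `toMeromorphicNFOn g U` is
  holomorphic where the orders are `≥ 0` and agrees with `g` on any open set where `g` is already holomorphic;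
* `exists_correction_family`: THE GLUE — from a family `E : X → ℂ → ℂ`, meromorphic on `{Re s > a}` with orders `≥ 0` off `s₀` and `≥ −1`
  at `s₀`, holomorphic on `{Re s > c}` (the convergence half-plane), produce `Ec : ℂ → X → ℂ`, `R : X → ℂ` with `Ec s x = E x s` on
  `Re s > c`, `s ↦ Ec s x` holomorphic on `Ω`, `(s − s₀)·Ec s x → R x` — exactly clauses (B1) of socket #41;
* `eqOn_of_eqOn_halfPlane`, `residue_eq_of_eqOn_halfPlane`: identity principle on `Ω` — two holomorphic functions on `Ω` that agree on
  `Re s > c` agree on `Ω` and have the same `(s − s₀)`-limit (transports left `H(L⁺)`-invariance ★ #10b and every pointwise symmetry of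
  the convergent series to `Ec` and `R`).
HONEST LABEL.  Count-neutral helper; `HC_CM` is proved only modulo the 7 printed citations (hLiu418 = 24832, h413 = 24833) until rung 0 closes.

## References
* [MoeglinWaldspurger1995] C. Mœglin, J.-L. Waldspurger, *Spectral decomposition and Eisenstein series*, CUP (1995), IV.1.8–IV.1.11.
* [Tan1999] V. Tan, *Poles of Siegel Eisenstein series on U(n,n)*, Canad. J. Math. 51 (1999), §1, §3.
-/

noncomputable section

open Filter Topology Set Complex

namespace Summit.HodgeConjecture.HodgeConjecture.Cruxes.HLiu418.K2LiuEisensteinContinuationGlue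

/-! ## §1 The domain `{Re s > a} ∖ {s₀}` -/

/-- `{Re s > a} ∖ {s₀}` is open. [folklore] -/
theorem isOpen_halfPlane_diff_singleton (a : ℝ) (s₀ : ℂ) : IsOpen ({s : ℂ | a < s.re} \ {s₀}) :=
  (isOpen_lt continuous_const Complex.continuous_re).sdiff isClosed_singleton

/-- `{Re s > a} ∖ {s₀}` is preconnected (union of the four convex pieces above ∕ below ∕ right ∕ left of `s₀`). [folklore] -/
theorem isPreconnected_halfPlane_diff_singleton (a : ℝ) (s₀ : ℂ) : IsPreconnected ({s : ℂ | a < s.re} \ {s₀}) := by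
  have hTu : Convex ℝ ({s : ℂ | a < s.re} ∩ {s : ℂ | s₀.im < s.im}) := (convex_halfSpace_re_gt a).inter (convex_halfSpace_im_gt _)
  have hTd : Convex ℝ ({s : ℂ | a < s.re} ∩ {s : ℂ | s.im < s₀.im}) := (convex_halfSpace_re_gt a).inter (convex_halfSpace_im_lt _)
  have hVr : Convex ℝ ({s : ℂ | a < s.re} ∩ {s : ℂ | s₀.re < s.re}) := (convex_halfSpace_re_gt a).inter (convex_halfSpace_re_gt _)
  have hVl : Convex ℝ ({s : ℂ | a < s.re} ∩ {s : ℂ | s.re < s₀.re}) := (convex_halfSpace_re_gt a).inter (convex_halfSpace_re_lt _)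
  -- the right piece meets the upper and the lower piece
  have hneu : (({s : ℂ | a < s.re} ∩ {s : ℂ | s₀.im < s.im}) ∩ ({s : ℂ | a < s.re} ∩ {s : ℂ | s₀.re < s.re})).Nonempty := by
    refine ⟨⟨max a s₀.re + 1, s₀.im + 1⟩, ⟨?_, ?_⟩, ?_, ?_⟩ <;> simp only [mem_setOf_eq] <;>
      linarith [le_max_left a s₀.re, le_max_right a s₀.re]
  have hned : (({s : ℂ | a < s.re} ∩ {s : ℂ | s₀.im < s.im} ∪ {s : ℂ | a < s.re} ∩ {s : ℂ | s₀.re < s.re}) ∩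
      ({s : ℂ | a < s.re} ∩ {s : ℂ | s.im < s₀.im})).Nonempty := by
    refine ⟨⟨max a s₀.re + 1, s₀.im - 1⟩, Or.inr ⟨?_, ?_⟩, ?_, ?_⟩ <;> simp only [mem_setOf_eq] <;>
      linarith [le_max_left a s₀.re, le_max_right a s₀.re]
  have h3 : IsPreconnected ({s : ℂ | a < s.re} ∩ {s : ℂ | s₀.im < s.im} ∪ {s : ℂ | a < s.re} ∩ {s : ℂ | s₀.re < s.re} ∪
      {s : ℂ | a < s.re} ∩ {s : ℂ | s.im < s₀.im}) :=
    (IsPreconnected.union' hneu hTu.isPreconnected hVr.isPreconnected).union' hned hTd.isPreconnected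
  by_cases ha : a < s₀.re
  · -- the left piece is non-empty and meets the upper piece
    have hne : (({s : ℂ | a < s.re} ∩ {s : ℂ | s₀.im < s.im} ∪ {s : ℂ | a < s.re} ∩ {s : ℂ | s₀.re < s.re} ∪
        {s : ℂ | a < s.re} ∩ {s : ℂ | s.im < s₀.im}) ∩ ({s : ℂ | a < s.re} ∩ {s : ℂ | s.re < s₀.re})).Nonempty := by
      refine ⟨⟨(a + s₀.re) / 2, s₀.im + 1⟩, Or.inl (Or.inl ⟨?_, ?_⟩), ?_, ?_⟩ <;> simp only [mem_setOf_eq] <;> linarith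
    have h4 := h3.union' hne hVl.isPreconnected
    convert h4 using 1
    ext s
    simp only [Set.mem_sdiff, mem_setOf_eq, mem_singleton_iff, mem_union, mem_inter_iff]
    constructor
    · rintro ⟨hs, hne'⟩
      rcases lt_trichotomy s.im s₀.im with h | h | h
      · exact Or.inl (Or.inr ⟨hs, h⟩)
      · rcases lt_trichotomy s.re s₀.re with h' | h' | h'
        · exact Or.inr ⟨hs, h'⟩
        · exact absurd (Complex.ext h' h) hne'
        · exact Or.inl (Or.inl (Or.inr ⟨hs, h'⟩))
      · exact Or.inl (Or.inl (Or.inl ⟨hs, h⟩))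
    · rintro (((⟨hs, h⟩ | ⟨hs, h⟩) | ⟨hs, h⟩) | ⟨hs, h⟩) <;> refine ⟨hs, fun h' => ?_⟩ <;> rw [h'] at h <;> exact lt_irrefl _ h
  · convert h3 using 1
    ext s
    simp only [Set.mem_sdiff, mem_setOf_eq, mem_singleton_iff, mem_union, mem_inter_iff]
    constructor
    · rintro ⟨hs, hne'⟩
      rcases lt_trichotomy s.im s₀.im with h | h | h
      · exact Or.inr ⟨hs, h⟩
      · rcases lt_trichotomy s.re s₀.re with h' | h' | h'
        · exact absurd (lt_trans (lt_of_lt_of_le h' (not_lt.1 ha)) hs) (lt_irrefl _)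
        · exact absurd (Complex.ext h' h) hne'
        · exact Or.inl (Or.inr ⟨hs, h'⟩)
      · exact Or.inl (Or.inl ⟨hs, h⟩)
    · rintro ((⟨hs, h⟩ | ⟨hs, h⟩) | ⟨hs, h⟩) <;> refine ⟨hs, fun h' => ?_⟩ <;> rw [h'] at h <;> exact lt_irrefl _ h

/-! ## §2 Meromorphic bookkeeping: orders `≥ −1`, the holomorphic correction -/

/-- **Order `≥ −1` at `z₀` ⇒ `(z − z₀)·g(z)` has a limit along `𝓝[≠] z₀`** (the limit is the residue when the order is `−1`, else `0`).
[cite: Tan1999, §3] -/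
theorem tendsto_sub_mul_of_neg_one_le_meromorphicOrderAt {g : ℂ → ℂ} {z₀ : ℂ} (hg : MeromorphicAt g z₀)
    (h : (-1 : WithTop ℤ) ≤ meromorphicOrderAt g z₀) :
    ∃ r : ℂ, Tendsto (fun z => (z - z₀) * g z) (𝓝[≠] z₀) (𝓝 r) := by
  by_cases htop : meromorphicOrderAt g z₀ = ⊤
  · refine ⟨0, ?_⟩
    have h0 : (fun _ : ℂ => (0 : ℂ)) =ᶠ[𝓝[≠] z₀] fun z => (z - z₀) * g z := by
      filter_upwards [meromorphicOrderAt_eq_top_iff.1 htop] with z hz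
      rw [hz, mul_zero]
    exact tendsto_const_nhds.congr' h0
  · obtain ⟨n, hn⟩ := WithTop.ne_top_iff_exists.1 htop
    obtain ⟨g', hg'an, -, hev⟩ := (meromorphicOrderAt_eq_int_iff hg).1 hn.symm
    have hn1 : 0 ≤ n + 1 := by
      have h' : ((-1 : ℤ) : WithTop ℤ) ≤ (n : WithTop ℤ) := by rw [hn]; exact_mod_cast h
      have := WithTop.coe_le_coe.1 h'
      omega
    obtain ⟨m, hm⟩ := Int.eq_ofNat_of_zero_le hn1
    have hcont : ContinuousAt (fun z => (z - z₀) ^ m * g' z) z₀ :=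
      ((continuousAt_id.sub continuousAt_const).pow m).mul hg'an.continuousAt
    refine ⟨(z₀ - z₀) ^ m * g' z₀, (hcont.tendsto.mono_left nhdsWithin_le_nhds).congr' ?_⟩
    filter_upwards [hev, self_mem_nhdsWithin] with z hz hne
    have hne' : z - z₀ ≠ 0 := sub_ne_zero.2 hne
    rw [hz, smul_eq_mul, ← mul_assoc, mul_comm (z - z₀) ((z - z₀) ^ n), ← zpow_add_one₀ hne', hm, zpow_natCast]

/-- **The normal form is holomorphic where the orders are `≥ 0`.** [folklore] -/
theorem differentiableOn_toMeromorphicNFOn {g : ℂ → ℂ} {U V : Set ℂ} (hg : MeromorphicOn g U) (hVU : V ⊆ U)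
    (h : ∀ z ∈ V, 0 ≤ meromorphicOrderAt g z) : DifferentiableOn ℂ (toMeromorphicNFOn g U) V := by
  intro z hz
  have hNF : MeromorphicNFAt (toMeromorphicNFOn g U) z := meromorphicNFOn_toMeromorphicNFOn g U (hVU hz)
  have hord : 0 ≤ meromorphicOrderAt (toMeromorphicNFOn g U) z := by
    rw [meromorphicOrderAt_congr (hg.toMeromorphicNFOn_eq_self_on_nhdsNE (hVU hz))]
    exact h z hz
  exact (hNF.meromorphicOrderAt_nonneg_iff_analyticAt.1 hord).differentiableAt.differentiableWithinAt

/-- **The normal form agrees with `g` on any open set where `g` is holomorphic.** [folklore] -/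
theorem toMeromorphicNFOn_eqOn_of_differentiableOn {g : ℂ → ℂ} {U V : Set ℂ} (hg : MeromorphicOn g U) (hVU : V ⊆ U)
    (hV : IsOpen V) (hd : DifferentiableOn ℂ g V) : EqOn (toMeromorphicNFOn g U) g V := by
  intro z hz
  have han : AnalyticAt ℂ g z := hd.analyticOnNhd hV z hz
  rw [toMeromorphicNFOn_eq_toMeromorphicNFAt hg (hVU hz), toMeromorphicNFAt_eq_self.2 han.meromorphicNFAt]

/-- The `(z − z₀)`-limit survives the passage to the normal form. [folklore] -/
theorem tendsto_sub_mul_toMeromorphicNFOn {g : ℂ → ℂ} {U : Set ℂ} (hg : MeromorphicOn g U) {z₀ : ℂ} (hz₀ : z₀ ∈ U)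
    (h : (-1 : WithTop ℤ) ≤ meromorphicOrderAt g z₀) :
    ∃ r : ℂ, Tendsto (fun z => (z - z₀) * toMeromorphicNFOn g U z) (𝓝[≠] z₀) (𝓝 r) := by
  obtain ⟨r, hr⟩ := tendsto_sub_mul_of_neg_one_le_meromorphicOrderAt (hg z₀ hz₀) h
  refine ⟨r, hr.congr' ?_⟩
  filter_upwards [hg.toMeromorphicNFOn_eq_self_on_nhdsNE hz₀] with z hz
  rw [hz]

/-! ## §3 THE GLUE: from meromorphic families with controlled orders to the socket's `(Ec, R)` -/

/-- **THE GLUE for socket #41.**  Let `E : X → ℂ → ℂ` be a family (in the application: `X = H(𝔸)`, `E x` any meromorphic continuation of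
`s ↦ E^Δ(x; f_s)`) such that every `E x` is meromorphic on the half-plane `{Re s > a}`, with order `≥ 0` at every `s ≠ s₀` there and `≥ −1`
at `s₀`, and holomorphic on the convergence half-plane `{Re s > c}`, `a ≤ c`.  Then there are `Ec : ℂ → X → ℂ` and `R : X → ℂ` with
`Ec s x = E x s` for `Re s > c`, `s ↦ Ec s x` holomorphic on `{Re s > a} ∖ {s₀}`, and `(s − s₀)·Ec s x → R x` along `𝓝[≠] s₀` — the clauses
(B1) of `sig_K2LiuSiegelEisensteinContinuation` (`a = 0`, `s₀ = ½`, `c = 1`). [cite: MoeglinWaldspurger1995, IV.1.8–IV.1.11] [cite: Tan1999, §3] -/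
theorem exists_correction_family {X : Type*} (E : X → ℂ → ℂ) {a c : ℝ} {s₀ : ℂ} (hc : a ≤ c) (hs₀ : a < s₀.re)
    (hmer : ∀ x, MeromorphicOn (E x) {s : ℂ | a < s.re})
    (hord : ∀ x, ∀ s : ℂ, a < s.re → s ≠ s₀ → 0 ≤ meromorphicOrderAt (E x) s)
    (hord₀ : ∀ x, (-1 : WithTop ℤ) ≤ meromorphicOrderAt (E x) s₀)
    (hhol : ∀ x, DifferentiableOn ℂ (E x) {s : ℂ | c < s.re}) :
    ∃ (Ec : ℂ → X → ℂ) (R : X → ℂ),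
      (∀ x, ∀ s : ℂ, c < s.re → Ec s x = E x s) ∧
      (∀ x, DifferentiableOn ℂ (fun s => Ec s x) ({s : ℂ | a < s.re} \ {s₀})) ∧
      (∀ x, Tendsto (fun s => (s - s₀) * Ec s x) (𝓝[≠] s₀) (𝓝 (R x))) := by
  have hU : IsOpen {s : ℂ | a < s.re} := isOpen_lt continuous_const Complex.continuous_re
  have hcU : {s : ℂ | c < s.re} ⊆ {s : ℂ | a < s.re} := fun z hz => lt_of_le_of_lt hc hz
  refine ⟨fun s x => toMeromorphicNFOn (E x) {s : ℂ | a < s.re} s,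
    fun x => (tendsto_sub_mul_toMeromorphicNFOn (hmer x) hs₀ (hord₀ x)).choose, ?_, ?_, ?_⟩
  · intro x s hs
    exact toMeromorphicNFOn_eqOn_of_differentiableOn (hmer x) hcU (isOpen_lt continuous_const Complex.continuous_re) (hhol x) hs
  · intro x
    exact differentiableOn_toMeromorphicNFOn (hmer x) sdiff_subset (fun z hz => hord x z hz.1 hz.2)
  · intro x
    exact (tendsto_sub_mul_toMeromorphicNFOn (hmer x) hs₀ (hord₀ x)).choose_spec

/-! ## §4 The identity principle on `{Re s > a} ∖ {s₀}` (transport of symmetries to `Ec` and `R`) -/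

/-- **Identity principle on `Ω = {Re s > a} ∖ {s₀}`**: two functions holomorphic on `Ω` that agree on the half-plane `{Re s > c}`, `a ≤ c`,
agree on `Ω`.  (Transports, e.g., left `H(L⁺)`-invariance of the convergent Eisenstein series ★ `siegelEisensteinDoubledLeftInvariant`
to its continuation.) [cite: Tan1999, §1] -/
theorem eqOn_of_eqOn_halfPlane {E₁ E₂ : ℂ → ℂ} {a c : ℝ} {s₀ : ℂ} (hc : a ≤ c)
    (h₁ : DifferentiableOn ℂ E₁ ({s : ℂ | a < s.re} \ {s₀})) (h₂ : DifferentiableOn ℂ E₂ ({s : ℂ | a < s.re} \ {s₀}))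
    (heq : ∀ s : ℂ, c < s.re → E₁ s = E₂ s) : EqOn E₁ E₂ ({s : ℂ | a < s.re} \ {s₀}) := by
  have hΩ : IsOpen ({s : ℂ | a < s.re} \ {s₀}) := isOpen_halfPlane_diff_singleton a s₀
  have hz₁c : c < (⟨max c s₀.re + 1, s₀.im⟩ : ℂ).re := by
    simp only
    linarith [le_max_left c s₀.re]
  have hz₁ : (⟨max c s₀.re + 1, s₀.im⟩ : ℂ) ∈ {s : ℂ | a < s.re} \ {s₀} := by
    refine ⟨lt_of_le_of_lt hc hz₁c, fun h => ?_⟩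
    have h' := congrArg Complex.re h
    simp only at h'
    linarith [le_max_right c s₀.re]
  have hev : E₁ =ᶠ[𝓝 (⟨max c s₀.re + 1, s₀.im⟩ : ℂ)] E₂ := by
    filter_upwards [(isOpen_lt continuous_const Complex.continuous_re).mem_nhds hz₁c] with s hs using heq s hs
  exact (h₁.analyticOnNhd hΩ).eqOn_of_preconnected_of_eventuallyEq (h₂.analyticOnNhd hΩ)
    (isPreconnected_halfPlane_diff_singleton a s₀) hz₁ hev

/-- **… and then their `(s − s₀)`-limits coincide** (so the residue `R` inherits every symmetry of the series). [cite: Tan1999, §3] -/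
theorem residue_eq_of_eqOn_halfPlane {E₁ E₂ : ℂ → ℂ} {a c : ℝ} {s₀ : ℂ} (hc : a ≤ c) (hs₀ : a < s₀.re)
    (h₁ : DifferentiableOn ℂ E₁ ({s : ℂ | a < s.re} \ {s₀})) (h₂ : DifferentiableOn ℂ E₂ ({s : ℂ | a < s.re} \ {s₀}))
    (heq : ∀ s : ℂ, c < s.re → E₁ s = E₂ s) {r₁ r₂ : ℂ}
    (hr₁ : Tendsto (fun s => (s - s₀) * E₁ s) (𝓝[≠] s₀) (𝓝 r₁)) (hr₂ : Tendsto (fun s => (s - s₀) * E₂ s) (𝓝[≠] s₀) (𝓝 r₂)) :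
    r₁ = r₂ := by
  have hE := eqOn_of_eqOn_halfPlane hc h₁ h₂ heq
  have hmem : ({s : ℂ | a < s.re} \ {s₀}) ∈ 𝓝[≠] s₀ := by
    have h1 : {s : ℂ | a < s.re} ∈ 𝓝 s₀ := (isOpen_lt continuous_const Complex.continuous_re).mem_nhds hs₀
    exact sdiff_mem_nhdsWithin_compl h1 {s₀}
  have hev : (fun s => (s - s₀) * E₁ s) =ᶠ[𝓝[≠] s₀] fun s => (s - s₀) * E₂ s := by
    filter_upwards [hmem] with s hs
    rw [hE hs]
  exact tendsto_nhds_unique (hr₁.congr' hev) hr₂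

end Summit.HodgeConjecture.HodgeConjecture.Cruxes.HLiu418.K2LiuEisensteinContinuationGlue
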